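import Mathlib
import HarnessLib

/-!
# Smith normal form over valuation rings; the Cartan decomposition
# `GL_n(K) = SL_n(O) · T(K) · SL_n(O)`

Topic `LinearAlgebra/Matrix`; theorems only. Let `O` be a valuation ring (an integral domain in
which divisibility is a total preorder, Mathlib's `ValuationRing`). Then every square matrix over
`O` is equivalent to a diagonal one:

* `exists_isUnit_mul_diagonal_mul` — for `M : Matrix n n O` there are `P, Q` with unit
  determinants and `d` with `M = P * diagonal d * Q` (Kaplansky 1949: valuation rings are
  elementary divisor rings; here without the divisibility chain `d₁ ∣ d₂ ∣ ⋯`, which we do not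
  need).
* `exists_sl_mul_diagonal_mul_sl` — the same with `det P = det Q = 1` (the unit determinants are
  pushed into the diagonal; `n` nonempty).
* `ValuationSubring.exists_sl_mul_diagonal_mul_sl` — for a valuation subring `O` of a field `K` and
  any `γ : Matrix n n K`: `γ = P · diagonal d · Q` with `P, Q ∈ SL_n(O)` and `d : n → K` — the
  Cartan (or Iwahori–Bruhat `KAK`) decomposition of `GL_n` over a valued field, the input of the
  valuative proof of the Hilbert–Mumford criterion (Mumford, GIT, Ch. 2 §1; Kempf 1978).

Proof: Gaussian elimination with full pivoting, the pivot being an entry of MINIMAL valuation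
(one dividing all other entries, `exists_dvd_forall`), moved to the last row and column by
permutations; one block step (`fromBlocks_elim`) clears the last row and column by unitriangular
block matrices, and induction on the size finishes (`exists_isUnit_mul_diagonal_mul_fin`); general
finite index types by transport along `Fintype.equivFin`. For matrices over the fraction field one
first clears denominators by the product of the inverses of the non-integral entries.

## References

* I. Kaplansky, *Elementary divisors and modules*, Trans. AMS 66 (1949) 464–491 (valuation
  rings are elementary divisor rings); the folklore form proved here keeps no divisibility chain.
* D. Mumford, J. Fogarty, F. Kirwan, *Geometric Invariant Theory*, Ch. 2 §1 (Iwahori's theorem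
  `G(K) = G(O)·T(K)·G(O)` in the proof of Thm. 2.1).
-/

open Matrix

namespace Literature.LinearAlgebra.Matrix

/-! ### A minimal element for divisibility in a valuation ring -/

/-- In a ring with total divisibility (`PreValuationRing`), a nonempty finite family has a member
dividing all the others. [folklore] -/
theorem exists_dvd_forall {O : Type*} [CommRing O] [PreValuationRing O] {ι : Type*}
    (s : Finset ι) (hs : s.Nonempty) (f : ι → O) : ∃ i₀ ∈ s, ∀ i ∈ s, f i₀ ∣ f i := by
  classical
  induction s using Finset.induction_on with
  | empty => exact absurd hs Finset.not_nonempty_empty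
  | insert a s ha ih =>
    rcases s.eq_empty_or_nonempty with rfl | hne
    · exact ⟨a, Finset.mem_insert_self a _, fun i hi => by
        rw [Finset.mem_insert] at hi
        rcases hi with rfl | hi
        · exact dvd_rfl
        · exact absurd hi (Finset.notMem_empty i)⟩
    obtain ⟨i₀, hi₀, h⟩ := ih hne
    rcases ValuationRing.dvd_total (f a) (f i₀) with hd | hd
    · refine ⟨a, Finset.mem_insert_self a s, fun i hi => ?_⟩
      rw [Finset.mem_insert] at hi
      rcases hi with rfl | hi
      · exact dvd_rfl
      · exact hd.trans (h i hi)
    · refine ⟨i₀, Finset.mem_insert_of_mem hi₀, fun i hi => ?_⟩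
      rw [Finset.mem_insert] at hi
      rcases hi with rfl | hi
      · exact hd
      · exact h i hi

/-! ### One step of elimination, in block form -/

section Block

variable {R : Type*} [CommRing R] {m u : Type*} [Fintype m] [DecidableEq m] [Fintype u]
  [DecidableEq u]

/-- **Block elimination.** If the off-diagonal blocks are multiples of the corner block `d`,
`b = b' d` and `c = d c'`, then unitriangular block matrices clear them:
`[1 -b'; 0 1] · [A, b' d; d c', d] · [1 0; -c' 1] = [A - b' d c', 0; 0, d]`. [folklore] -/
theorem fromBlocks_elim (A : Matrix m m R) (b' : Matrix m u R) (c' : Matrix u m R)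
    (d : Matrix u u R) :
    fromBlocks 1 (-b') 0 1 * fromBlocks A (b' * d) (d * c') d * fromBlocks 1 0 (-c') 1 =
      fromBlocks (A - b' * (d * c')) 0 0 d := by
  rw [fromBlocks_multiply, fromBlocks_multiply]
  congr 1
  · simp only [Matrix.one_mul, Matrix.mul_one, Matrix.neg_mul, add_neg_cancel, Matrix.zero_mul,
      add_zero, sub_eq_add_neg]
  · simp
  · simp
  · simp

/-- The unitriangular block matrices are inverse to each other (upper). [folklore] -/
theorem fromBlocks_one_neg_mul (b' : Matrix m u R) :
    fromBlocks (1 : Matrix m m R) b' 0 (1 : Matrix u u R) * fromBlocks 1 (-b') 0 1 = 1 := by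
  rw [fromBlocks_multiply, ← fromBlocks_one]
  congr 1 <;> simp

/-- The unitriangular block matrices are inverse to each other (lower). [folklore] -/
theorem fromBlocks_neg_one_mul (c' : Matrix u m R) :
    fromBlocks (1 : Matrix m m R) 0 (-c') (1 : Matrix u u R) * fromBlocks 1 0 c' 1 = 1 := by
  rw [fromBlocks_multiply, ← fromBlocks_one]
  congr 1 <;> simp

/-- Solving the elimination identity for the middle factor:
`[A, b'd; dc', d] = [1 b'; 0 1] · [A - b'dc', 0; 0, d] · [1 0; c' 1]`. [folklore] -/
theorem fromBlocks_eq_mul_elim_mul (A : Matrix m m R) (b' : Matrix m u R) (c' : Matrix u m R)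
    (d : Matrix u u R) :
    fromBlocks A (b' * d) (d * c') d =
      fromBlocks 1 b' 0 1 * fromBlocks (A - b' * (d * c')) 0 0 d * fromBlocks 1 0 c' 1 := by
  rw [← fromBlocks_elim A b' c' d]
  have h1 := fromBlocks_one_neg_mul (R := R) b'
  have h2 := fromBlocks_neg_one_mul (R := R) c'
  calc fromBlocks A (b' * d) (d * c') d
      = (fromBlocks 1 b' 0 1 * fromBlocks 1 (-b') 0 1) * fromBlocks A (b' * d) (d * c') d *
          (fromBlocks 1 0 (-c') 1 * fromBlocks 1 0 c' 1) := by rw [h1, h2, Matrix.one_mul, Matrix.mul_one]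
    _ = fromBlocks 1 b' 0 1 * (fromBlocks 1 (-b') 0 1 * fromBlocks A (b' * d) (d * c') d *
          fromBlocks 1 0 (-c') 1) * fromBlocks 1 0 c' 1 := by
        simp only [Matrix.mul_assoc]

omit [DecidableEq m] in
/-- A block-diagonal matrix with factored corner: `[P e Q, 0; 0, d] = [P 0; 0 1]·[e 0; 0 d]·[Q 0; 0 1]`.
[folklore] -/
theorem fromBlocks_mul_zero_zero (P E Q : Matrix m m R) (d : Matrix u u R) :
    fromBlocks (P * E * Q) 0 0 d = fromBlocks P 0 0 1 * fromBlocks E 0 0 d * fromBlocks Q 0 0 1 := by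
  rw [fromBlocks_multiply, fromBlocks_multiply]
  congr 1 <;> simp

end Block

/-! ### Diagonal reduction over a valuation ring -/

section Smith

variable {O : Type*} [CommRing O] [IsDomain O] [ValuationRing O]

/-- **Smith normal form over a valuation ring, on `Fin r`** (induction on `r`): every
`M : Matrix (Fin r) (Fin r) O` is `P · diagonal d · Q` with `det P`, `det Q` units. [folklore] -/
theorem exists_isUnit_mul_diagonal_mul_fin :
    ∀ (r : ℕ) (M : Matrix (Fin r) (Fin r) O), ∃ (P Q : Matrix (Fin r) (Fin r) O) (d : Fin r → O),
      IsUnit P.det ∧ IsUnit Q.det ∧ M = P * diagonal d * Q := by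
  intro r
  induction r with
  | zero =>
    intro M
    exact ⟨1, 1, fun _ => 0, by simp, by simp, Subsingleton.elim _ _⟩
  | succ r ih =>
    intro M
    classical
    -- a pivot dividing every entry
    obtain ⟨⟨i₀, j₀⟩, -, hdiv⟩ := exists_dvd_forall (Finset.univ : Finset (Fin (r + 1) × Fin (r + 1)))
      Finset.univ_nonempty (fun ij => M ij.1 ij.2)
    have hdvd : ∀ i j, M i₀ j₀ ∣ M i j := fun i j => hdiv (i, j) (Finset.mem_univ _)
    -- move it to the last row and column
    set σ : Equiv.Perm (Fin (r + 1)) := Equiv.swap i₀ (Fin.last r) with hσ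
    set τ : Equiv.Perm (Fin (r + 1)) := Equiv.swap j₀ (Fin.last r) with hτ
    set E : Fin r ⊕ Fin 1 ≃ Fin (r + 1) := finSumFinEquiv with hE
    set M₂ : Matrix (Fin r ⊕ Fin 1) (Fin r ⊕ Fin 1) O := (M.submatrix σ τ).submatrix E E with hM₂
    have hElast : E (Sum.inr 0) = Fin.last r := by
      rw [hE, finSumFinEquiv_apply_right]
      ext
      simp
    have hM₂entry : ∀ x y, M i₀ j₀ ∣ M₂ x y := fun x y => hdvd _ _
    have hpiv : M₂ (Sum.inr 0) (Sum.inr 0) = M i₀ j₀ := by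
      simp [hM₂, hElast, hσ, hτ, Equiv.swap_apply_right]
    -- the blocks and the quotients
    set A := M₂.toBlocks₁₁ with hA
    set p : O := M i₀ j₀ with hp
    choose β hβ using fun i : Fin r => hM₂entry (Sum.inl i) (Sum.inr 0)
    choose γ hγ using fun j : Fin r => hM₂entry (Sum.inr 0) (Sum.inl j)
    set b' : Matrix (Fin r) (Fin 1) O := Matrix.of fun i _ => β i with hb'
    set c' : Matrix (Fin 1) (Fin r) O := Matrix.of fun _ j => γ j with hc'
    set dd : Matrix (Fin 1) (Fin 1) O := Matrix.of fun _ _ => p with hdd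
    have hM₂blocks : M₂ = fromBlocks A (b' * dd) (dd * c') dd := by
      rw [← fromBlocks_toBlocks M₂]
      congr 1
      · ext i k
        have hk : k = 0 := Subsingleton.elim _ _
        subst hk
        rw [Matrix.mul_apply, Fintype.sum_unique]
        simp only [toBlocks₁₂, of_apply, hb', hdd]
        rw [hβ i, hp, mul_comm]
      · ext k j
        have hk : k = 0 := Subsingleton.elim _ _
        subst hk
        rw [Matrix.mul_apply, Fintype.sum_unique]
        simp only [toBlocks₂₁, of_apply, hc', hdd]
        rw [hγ j, hp]
      · ext k k'
        have hk : k = 0 := Subsingleton.elim _ _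
        have hk' : k' = 0 := Subsingleton.elim _ _
        subst hk; subst hk'
        simp only [toBlocks₂₂, of_apply, hdd]
        rw [hpiv]
    -- induction on the top-left block after elimination
    obtain ⟨P', Q', e, hP', hQ', hA'⟩ := ih (A - b' * (dd * c'))
    -- assemble over `Fin r ⊕ Fin 1`
    set P₂ : Matrix (Fin r ⊕ Fin 1) (Fin r ⊕ Fin 1) O := fromBlocks 1 b' 0 1 * fromBlocks P' 0 0 1
      with hP₂
    set Q₂ : Matrix (Fin r ⊕ Fin 1) (Fin r ⊕ Fin 1) O := fromBlocks Q' 0 0 1 * fromBlocks 1 0 c' 1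
      with hQ₂
    set d₂ : Fin r ⊕ Fin 1 → O := Sum.elim e fun _ => p with hd₂
    have hM₂eq : M₂ = P₂ * diagonal d₂ * Q₂ := by
      rw [hM₂blocks, fromBlocks_eq_mul_elim_mul, hA', fromBlocks_mul_zero_zero, hP₂, hQ₂, hd₂,
        ← fromBlocks_diagonal]
      have : dd = diagonal fun _ : Fin 1 => p := by
        ext k k'
        have hk : k = 0 := Subsingleton.elim _ _
        have hk' : k' = 0 := Subsingleton.elim _ _
        subst hk; subst hk'
        simp [hdd]
      rw [this]
      simp only [Matrix.mul_assoc]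
    have hP₂u : IsUnit P₂.det := by
      rw [hP₂, det_mul, det_fromBlocks_zero₂₁, det_fromBlocks_zero₂₁]
      simp [hP']
    have hQ₂u : IsUnit Q₂.det := by
      rw [hQ₂, det_mul, det_fromBlocks_zero₂₁, det_fromBlocks_zero₁₂]
      simp [hQ']
    -- transport back to `Fin (r + 1)`
    have hM₁ : M.submatrix σ τ = P₂.submatrix E.symm E.symm * diagonal (d₂ ∘ E.symm) *
        Q₂.submatrix E.symm E.symm := by
      have : M.submatrix σ τ = M₂.submatrix E.symm E.symm := by
        rw [hM₂, submatrix_submatrix]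
        simp
      rw [this, hM₂eq, ← submatrix_mul_equiv _ _ _ E.symm, ← submatrix_mul_equiv _ _ _ E.symm,
        submatrix_diagonal_equiv]
    have hM : M = (P₂.submatrix E.symm E.symm).submatrix σ.symm id * diagonal (d₂ ∘ E.symm) *
        (Q₂.submatrix E.symm E.symm).submatrix id τ.symm := by
      have : M = (M.submatrix σ τ).submatrix σ.symm τ.symm := by
        rw [submatrix_submatrix]
        simp
      rw [this, hM₁, submatrix_mul _ _ _ (id : Fin (r + 1) → Fin (r + 1)) _ Function.bijective_id,
        submatrix_mul _ _ _ (id : Fin (r + 1) → Fin (r + 1)) _ Function.bijective_id, submatrix_id_id]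
    refine ⟨_, _, _, ?_, ?_, hM⟩
    · rw [det_permute, det_submatrix_equiv_self]
      exact ((Equiv.Perm.sign σ.symm).isUnit.map (Int.castRingHom O)).mul hP₂u
    · rw [det_permute', det_submatrix_equiv_self]
      exact ((Equiv.Perm.sign τ.symm).isUnit.map (Int.castRingHom O)).mul hQ₂u

/-- **Smith normal form over a valuation ring**: every square matrix over a valuation ring `O` is
`P · diagonal d · Q` with `det P`, `det Q` units of `O`. [folklore] -/
theorem exists_isUnit_mul_diagonal_mul {n : Type*} [Fintype n] [DecidableEq n] (M : Matrix n n O) :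
    ∃ (P Q : Matrix n n O) (d : n → O), IsUnit P.det ∧ IsUnit Q.det ∧ M = P * diagonal d * Q := by
  classical
  set e := Fintype.equivFin n with he
  obtain ⟨P', Q', d', hP', hQ', hM'⟩ :=
    exists_isUnit_mul_diagonal_mul_fin (Fintype.card n) (M.submatrix e.symm e.symm)
  refine ⟨P'.submatrix e e, Q'.submatrix e e, d' ∘ e, ?_, ?_, ?_⟩
  · rwa [det_submatrix_equiv_self]
  · rwa [det_submatrix_equiv_self]
  · have : M = (M.submatrix e.symm e.symm).submatrix e e := by
      rw [submatrix_submatrix]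
      simp
    rw [this, hM', ← submatrix_mul_equiv _ _ _ e, ← submatrix_mul_equiv _ _ _ e,
      submatrix_diagonal_equiv]

/-- **Smith normal form with unimodular outer factors**: every square matrix over a valuation ring
is `P · diagonal d · Q` with `det P = det Q = 1` (push the unit determinants into the diagonal).
[folklore] -/
theorem exists_sl_mul_diagonal_mul_sl {n : Type*} [Fintype n] [DecidableEq n] (M : Matrix n n O) :
    ∃ (P Q : Matrix n n O) (d : n → O), P.det = 1 ∧ Q.det = 1 ∧ M = P * diagonal d * Q := by
  classical
  obtain ⟨P, Q, d, ⟨u, hu⟩, ⟨w, hw⟩, hM⟩ := exists_isUnit_mul_diagonal_mul M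
  rcases isEmpty_or_nonempty n with hn | ⟨⟨i₀⟩⟩
  · exact ⟨P, Q, d, by simp [det_isEmpty], by simp [det_isEmpty], hM⟩
  -- correcting diagonal matrices
  set Du : Matrix n n O := diagonal (Function.update 1 i₀ (u : O)) with hDu
  set Du' : Matrix n n O := diagonal (Function.update 1 i₀ ((u⁻¹ : Oˣ) : O)) with hDu'
  set Dw : Matrix n n O := diagonal (Function.update 1 i₀ (w : O)) with hDw
  set Dw' : Matrix n n O := diagonal (Function.update 1 i₀ ((w⁻¹ : Oˣ) : O)) with hDw'
  have hprod : ∀ x : Oˣ, (∏ i, Function.update (1 : n → O) i₀ (x : O) i) = x := by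
    intro x
    rw [Finset.prod_update_of_mem (Finset.mem_univ i₀)]
    simp
  have huu : Du' * Du = 1 := by
    rw [hDu', hDu, diagonal_mul_diagonal, ← diagonal_one]
    congr 1
    funext i
    by_cases hi : i = i₀
    · subst hi; simp
    · simp [Function.update_of_ne hi]
  have hww : Dw * Dw' = 1 := by
    rw [hDw, hDw', diagonal_mul_diagonal, ← diagonal_one]
    congr 1
    funext i
    by_cases hi : i = i₀
    · subst hi; simp
    · simp [Function.update_of_ne hi]
  refine ⟨P * Du', Dw' * Q, fun i => Function.update (1 : n → O) i₀ (u : O) i * d i *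
      Function.update (1 : n → O) i₀ (w : O) i, ?_, ?_, ?_⟩
  · rw [det_mul, ← hu, hDu', det_diagonal, hprod, Units.mul_inv]
  · rw [det_mul, ← hw, hDw', det_diagonal, hprod, Units.inv_mul]
  · have hdiag : diagonal (fun i => Function.update (1 : n → O) i₀ (u : O) i * d i *
        Function.update (1 : n → O) i₀ (w : O) i) = Du * diagonal d * Dw := by
      rw [hDu, hDw, diagonal_mul_diagonal, diagonal_mul_diagonal]
    rw [hdiag]
    calc M = P * diagonal d * Q := hM
      _ = P * (Du' * Du) * diagonal d * (Dw * Dw') * Q := by rw [huu, hww, Matrix.mul_one, Matrix.mul_one]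
      _ = P * Du' * (Du * diagonal d * Dw) * (Dw' * Q) := by simp only [Matrix.mul_assoc]

end Smith

/-! ### Over the fraction field: the Cartan decomposition -/

section Field

variable {K : Type*} [Field K] (O : ValuationSubring K)

/-- A finite family of elements of `K` has a common denominator in the valuation subring `O`:
the product of the inverses of its non-integral members. [folklore] -/
theorem _root_.ValuationSubring.exists_mul_mem_forall {ι : Type*} [Fintype ι] (x : ι → K) :
    ∃ s : O, (s : K) ≠ 0 ∧ ∀ i, (s : K) * x i ∈ O := by
  classical
  set S : Finset ι := Finset.univ.filter fun i => x i ∉ O with hS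
  have hinv : ∀ i ∈ S, (x i)⁻¹ ∈ O := by
    intro i hi
    rw [hS, Finset.mem_filter] at hi
    exact (O.mem_or_inv_mem (x i)).resolve_left hi.2
  have hne : ∀ i ∈ S, x i ≠ 0 := by
    intro i hi h0
    rw [hS, Finset.mem_filter] at hi
    exact hi.2 (h0 ▸ O.zero_mem)
  set s : K := ∏ i ∈ S, (x i)⁻¹ with hs
  have hsmem : s ∈ O := by
    rw [hs]
    exact prod_mem fun i hi => hinv i hi
  refine ⟨⟨s, hsmem⟩, ?_, fun i => ?_⟩
  · show s ≠ 0
    rw [hs]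
    exact Finset.prod_ne_zero_iff.mpr fun i hi => inv_ne_zero (hne i hi)
  · show s * x i ∈ O
    by_cases hi : i ∈ S
    · rw [hs, ← Finset.prod_erase_mul S _ hi, mul_assoc, inv_mul_cancel₀ (hne i hi), mul_one]
      exact prod_mem fun j hj => hinv j (Finset.mem_of_mem_erase hj)
    · have hxi : x i ∈ O := by
        by_contra h
        exact hi (by rw [hS, Finset.mem_filter]; exact ⟨Finset.mem_univ _, h⟩)
      exact mul_mem hsmem hxi

/-- **Cartan decomposition `GL_n(K) ⊆ SL_n(O) · T(K) · SL_n(O)`** for a valuation subring `O` of a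
field `K` (Iwahori; Mumford–Fogarty–Kirwan, GIT, Ch. 2 §1): every square matrix `γ` over `K` is
`P · diagonal d · Q` with `P, Q` over `O` of determinant `1` and `d : n → K` (here `γ` need not be
invertible; for invertible `γ` all `d i ≠ 0`). [folklore] -/
theorem _root_.ValuationSubring.exists_sl_mul_diagonal_mul_sl {n : Type*} [Fintype n] [DecidableEq n]
    (γ : Matrix n n K) :
    ∃ (P Q : Matrix n n O) (d : n → K), P.det = 1 ∧ Q.det = 1 ∧
      γ = P.map O.subtype * diagonal d * Q.map O.subtype := by
  obtain ⟨s, hs0, hs⟩ := O.exists_mul_mem_forall fun ij : n × n => γ ij.1 ij.2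
  set M : Matrix n n O := Matrix.of fun i j => ⟨(s : K) * γ i j, hs (i, j)⟩ with hM
  obtain ⟨P, Q, d, hP, hQ, hMeq⟩ := Literature.LinearAlgebra.Matrix.exists_sl_mul_diagonal_mul_sl M
  have hmap : M.map O.subtype = (s : K) • γ := by
    ext i j
    simp [hM]
  have hmap' : M.map O.subtype = P.map O.subtype * diagonal (O.subtype ∘ d) * Q.map O.subtype := by
    rw [hMeq, ← RingHom.mapMatrix_apply, map_mul, map_mul, RingHom.mapMatrix_apply,
      RingHom.mapMatrix_apply, RingHom.mapMatrix_apply, diagonal_map (map_zero _)]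
    rfl
  refine ⟨P, Q, fun i => (s : K)⁻¹ * (d i : K), hP, hQ, ?_⟩
  have hγ : γ = (s : K)⁻¹ • ((s : K) • γ) := by rw [smul_smul, inv_mul_cancel₀ hs0, one_smul]
  rw [hγ, ← hmap, hmap']
  have : diagonal (fun i => (s : K)⁻¹ * (d i : K)) = (s : K)⁻¹ • diagonal (O.subtype ∘ d) := by
    rw [smul_eq_diagonal_mul, diagonal_mul_diagonal]
    rfl
  rw [this, Matrix.mul_smul, Matrix.smul_mul]

end Field



end Literature.LinearAlgebra.Matrix
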